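import Mathlib

/-!
# Tier3WeightPairing — (E5-a)(iv) of PERIOD.md §4.5 on the kernel (T3.5 for T3.1)

The archimedean clause (E5-a)(iv) of `proofs/t3-p1/PERIOD.md` §4.5 reads: «`F_{τ,v}` is the
`μ(v)`-weight vector, the `T_v`-weight spaces of `σ₀(v)` are one-dimensional, and the local theta
map is the contraction `F ⊗ a ⊗ w ↦ ⟨F, a⟩ w` — so `θ_v(F_{τ,v}, ϕ_v) = ⟨F_{τ,v}, a₀(v)⟩ · w ≠ 0`».
The elementary core of that sentence is a statement about a `G`-invariant pairing between two
representations `ρ`, `σ` of a group `G` (here `G = T_v`, a torus). The `χ`-weight space of `ρ`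
(`χ : G → k` a function) is written in Mathlib's own vocabulary as the simultaneous eigenspace
`⨅ g, Module.End.eigenspace (ρ g) (χ g)` — no new definition is introduced:

* two weight vectors of weights `χ`, `χ'` pair to `0` unless `χ · χ' = 1`
  (`pairing_eq_zero_of_weight_ne`);
* if `W` is spanned by its weight spaces, every vector `v` of weight `χ` that pairs non-trivially
  with SOMETHING pairs non-trivially with a vector of the opposite weight `g ↦ (χ g)⁻¹`
  (`exists_mem_weightSpace_pairing_ne_zero`) — i.e. a non-degenerate invariant pairing restricts
  to a non-degenerate pairing `V_χ × W_{χ⁻¹} → k` (`exists_pairing_ne_zero_of_nondegenerate`);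
* if moreover the opposite weight space `W_{χ⁻¹}` is ONE-dimensional, the contraction of ANY two
  non-zero weight vectors `v ∈ V_χ`, `a ∈ W_{χ⁻¹}` is non-zero (`pairing_ne_zero_of_finrank_eq_one`,
  assembled in `contraction_ne_zero`) — this is `⟨F_{τ,v}, a₀(v)⟩ ≠ 0` with
  `F_{τ,v} ∈ τ_v ≅ σ₀(v)^∨` and `a₀(v)` the lowest-weight vector of `σ₀(v)`, the pairing being
  the canonical one between `σ₀(v)^∨` and `σ₀(v)`.

Nothing analytic enters: no averaging, no Haar measure, no finiteness of `G` — only the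
orthogonality of distinct weights under an invariant pairing and the decomposition of `W` into
weight spaces (which for a finite-dimensional representation of a torus is the statement that the
torus acts diagonalisably). The weights are indexed by ALL functions `G → k`; a non-zero weight
vector forces its weight to be a homomorphism (`weight_mul_of_mem_weightSpace`,
`weight_one_of_mem_weightSpace`) and nowhere zero (`weight_ne_zero_of_mem_weightSpace`).

`Tier3WeightEquivariance` (LANDED.tsv row 638) is the (E5-a)(i)–(iii) half (an equivariant
integral vanishes unless the weights match); this file is the (iv) half. Nothing here asserts
anything about HC_CM. `import Mathlib` only; theorems only (no definition, no notation); every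
theorem proved, no `sorry`, standard axioms.
-/

set_option autoImplicit false

namespace HodgeRepro.T3P1.WeightPairing

open Module

variable {k : Type*} [Field k] {G : Type*} [Group G]
variable {V : Type*} [AddCommGroup V] [Module k V]
variable {W : Type*} [AddCommGroup W] [Module k W]

/-- Membership in the weight space `⨅ g, eigenspace (ρ g) (χ g)` of a representation `ρ` of `G`
on `V`, unfolded: `v` is a `χ`-weight vector iff `ρ g v = χ g • v` for every `g`. -/
theorem mem_weightSpace {ρ : Representation k G V} {χ : G → k} {v : V} :
    v ∈ ⨅ g, Module.End.eigenspace (ρ g) (χ g) ↔ ∀ g, ρ g v = χ g • v := by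
  rw [Submodule.mem_iInf]
  exact forall_congr' fun g => Module.End.mem_eigenspace_iff

/-- A non-zero weight vector has a nowhere-vanishing weight: `ρ g` is invertible, so
`ρ g v = χ g • v` with `χ g = 0` would force `v = 0`. -/
theorem weight_ne_zero_of_mem_weightSpace {ρ : Representation k G V} {χ : G → k} {v : V}
    (hv : v ∈ ⨅ g, Module.End.eigenspace (ρ g) (χ g)) (hv0 : v ≠ 0) (g : G) : χ g ≠ 0 := by
  rw [mem_weightSpace] at hv
  intro hg
  apply hv0
  have h1 : ρ g v = 0 := by rw [hv g, hg, zero_smul]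
  have h2 : ρ g⁻¹ (ρ g v) = v := by
    rw [← Module.End.mul_apply, ← map_mul, inv_mul_cancel, map_one, Module.End.one_apply]
  rw [h1, map_zero] at h2
  exact h2.symm

/-- The weight of a non-zero weight vector is multiplicative. -/
theorem weight_mul_of_mem_weightSpace {ρ : Representation k G V} {χ : G → k} {v : V}
    (hv : v ∈ ⨅ g, Module.End.eigenspace (ρ g) (χ g)) (hv0 : v ≠ 0) (g h : G) :
    χ (g * h) = χ g * χ h := by
  rw [mem_weightSpace] at hv
  have h1 : ρ (g * h) v = (χ g * χ h) • v := by
    rw [map_mul, Module.End.mul_apply, hv h, map_smul, hv g, smul_smul, mul_comm]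
  have h2 : (χ (g * h) - χ g * χ h) • v = 0 := by
    rw [sub_smul, ← hv (g * h), h1, sub_self]
  rcases smul_eq_zero.mp h2 with h3 | h3
  · exact sub_eq_zero.mp h3
  · exact absurd h3 hv0

/-- The weight of a non-zero weight vector takes the value `1` at the identity. -/
theorem weight_one_of_mem_weightSpace {ρ : Representation k G V} {χ : G → k} {v : V}
    (hv : v ∈ ⨅ g, Module.End.eigenspace (ρ g) (χ g)) (hv0 : v ≠ 0) : χ 1 = 1 := by
  rw [mem_weightSpace] at hv
  have h1 : (χ 1 - 1) • v = 0 := by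
    rw [sub_smul, one_smul, ← hv 1, map_one, Module.End.one_apply, sub_self]
  rcases smul_eq_zero.mp h1 with h2 | h2
  · exact sub_eq_zero.mp h2
  · exact absurd h2 hv0

/-- ORTHOGONALITY OF DISTINCT WEIGHTS: under a `G`-invariant pairing `B` (`B (ρ g v) (σ g w) =
B v w`), a vector of weight `χ` and a vector of weight `χ'` pair to zero as soon as
`χ g * χ' g ≠ 1` for one `g`. -/
theorem pairing_eq_zero_of_weight_ne {ρ : Representation k G V} {σ : Representation k G W}
    {B : V →ₗ[k] W →ₗ[k] k} (hB : ∀ g v w, B (ρ g v) (σ g w) = B v w) {χ χ' : G → k} {v : V}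
    {w : W} (hv : v ∈ ⨅ g, Module.End.eigenspace (ρ g) (χ g))
    (hw : w ∈ ⨅ g, Module.End.eigenspace (σ g) (χ' g)) (g : G) (hne : χ g * χ' g ≠ 1) :
    B v w = 0 := by
  rw [mem_weightSpace] at hv hw
  have h := hB g v w
  rw [hv g, hw g, LinearMap.map_smul₂, map_smul, smul_eq_mul, smul_eq_mul] at h
  have h2 : (χ g * χ' g - 1) * B v w = 0 := by
    rw [sub_mul, one_mul, mul_assoc, h, sub_self]
  rcases mul_eq_zero.mp h2 with h3 | h3
  · exact absurd (sub_eq_zero.mp h3) hne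
  · exact h3

omit [Group G] in
/-- If `χ'` is not the opposite weight `g ↦ (χ g)⁻¹` then some `g` has `χ g * χ' g ≠ 1`. -/
theorem exists_mul_ne_one_of_ne_inv {χ χ' : G → k} (h : χ' ≠ fun g => (χ g)⁻¹) :
    ∃ g, χ g * χ' g ≠ 1 := by
  by_contra hall
  apply h
  funext g
  by_contra hg
  exact hall ⟨g, fun h1 => hg (eq_inv_of_mul_eq_one_right h1)⟩

/-- THE RESTRICTION STEP: let `W` be spanned by its weight spaces. If a vector `v` of weight `χ`
pairs non-trivially with some `w ∈ W`, then it pairs non-trivially with a vector of the opposite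
weight `g ↦ (χ g)⁻¹` — namely with the `χ⁻¹`-component of `w`, all other components pairing to
zero by `pairing_eq_zero_of_weight_ne`. -/
theorem exists_mem_weightSpace_pairing_ne_zero {ρ : Representation k G V}
    {σ : Representation k G W} {B : V →ₗ[k] W →ₗ[k] k}
    (hB : ∀ g v w, B (ρ g v) (σ g w) = B v w)
    (hW : ⨆ χ' : G → k, ⨅ g, Module.End.eigenspace (σ g) (χ' g) = ⊤) {χ : G → k} {v : V}
    (hv : v ∈ ⨅ g, Module.End.eigenspace (ρ g) (χ g)) {w : W} (hvw : B v w ≠ 0) :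
    ∃ w' ∈ ⨅ g, Module.End.eigenspace (σ g) (χ g)⁻¹, B v w' ≠ 0 := by
  have hw : w ∈ ⨆ χ' : G → k, ⨅ g, Module.End.eigenspace (σ g) (χ' g) := by
    rw [hW]
    exact Submodule.mem_top
  obtain ⟨f, hf, rfl⟩ := (Submodule.mem_iSup_iff_exists_finsupp _ _).mp hw
  rw [Finsupp.sum, map_sum] at hvw
  obtain ⟨χ', -, hne⟩ := Finset.exists_ne_zero_of_sum_ne_zero hvw
  refine ⟨f χ', ?_, hne⟩
  by_cases h : χ' = fun g => (χ g)⁻¹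
  · subst h
    exact hf _
  · exfalso
    apply hne
    obtain ⟨g, hg⟩ := exists_mul_ne_one_of_ne_inv h
    exact pairing_eq_zero_of_weight_ne hB hv (hf χ') g hg

/-- A non-degenerate invariant pairing (every non-zero `v` pairs non-trivially with something)
restricts to a non-degenerate pairing `V_χ × W_{χ⁻¹} → k` whenever `W` is spanned by its weight
spaces. -/
theorem exists_pairing_ne_zero_of_nondegenerate {ρ : Representation k G V}
    {σ : Representation k G W} {B : V →ₗ[k] W →ₗ[k] k}
    (hB : ∀ g v w, B (ρ g v) (σ g w) = B v w)
    (hW : ⨆ χ' : G → k, ⨅ g, Module.End.eigenspace (σ g) (χ' g) = ⊤)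
    (hnd : ∀ v : V, v ≠ 0 → ∃ w : W, B v w ≠ 0) {χ : G → k} {v : V}
    (hv : v ∈ ⨅ g, Module.End.eigenspace (ρ g) (χ g)) (hv0 : v ≠ 0) :
    ∃ w' ∈ ⨅ g, Module.End.eigenspace (σ g) (χ g)⁻¹, B v w' ≠ 0 := by
  obtain ⟨w, hw⟩ := hnd v hv0
  exact exists_mem_weightSpace_pairing_ne_zero hB hW hv hw

/-- ONE-DIMENSIONAL WEIGHT SPACES ⇒ NON-ZERO CONTRACTION: if a weight space `W_ψ` is
one-dimensional, then a vector `v` pairing non-trivially with some vector of `W_ψ` pairs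
non-trivially with EVERY non-zero vector of `W_ψ`. -/
theorem pairing_ne_zero_of_finrank_eq_one {σ : Representation k G W} {B : V →ₗ[k] W →ₗ[k] k}
    {ψ : G → k} (h1 : finrank k ↥(⨅ g, Module.End.eigenspace (σ g) (ψ g)) = 1) {v : V} {w' : W}
    (hw' : w' ∈ ⨅ g, Module.End.eigenspace (σ g) (ψ g)) (hvw' : B v w' ≠ 0) {a : W}
    (ha : a ∈ ⨅ g, Module.End.eigenspace (σ g) (ψ g)) (ha0 : a ≠ 0) : B v a ≠ 0 := by
  have ha0' : (⟨a, ha⟩ : ↥(⨅ g, Module.End.eigenspace (σ g) (ψ g))) ≠ 0 := by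
    intro h
    apply ha0
    exact congrArg Subtype.val h
  obtain ⟨c, hc⟩ := (finrank_eq_one_iff_of_nonzero' _ ha0').mp h1 ⟨w', hw'⟩
  have hc' : c • a = w' := congrArg Subtype.val hc
  intro hva
  apply hvw'
  rw [← hc', map_smul, hva, smul_zero]

/-- (E5-a)(iv) ASSEMBLED: a `G`-invariant pairing `B` between `V` and `W`, non-degenerate in `v`,
with `W` spanned by its weight spaces and the opposite weight space `W_{χ⁻¹}` one-dimensional;
then for every non-zero weight vector `v ∈ V_χ` and every non-zero `a ∈ W_{χ⁻¹}` the contraction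
`B v a` is non-zero. In the application `V = τ_v ≅ σ₀(v)^∨`, `W = σ₀(v)`, `v = F_{τ,v}`,
`a = a₀(v)`, `B` = the canonical pairing. -/
theorem contraction_ne_zero {ρ : Representation k G V} {σ : Representation k G W}
    {B : V →ₗ[k] W →ₗ[k] k} (hB : ∀ g v w, B (ρ g v) (σ g w) = B v w)
    (hW : ⨆ χ' : G → k, ⨅ g, Module.End.eigenspace (σ g) (χ' g) = ⊤)
    (hnd : ∀ v : V, v ≠ 0 → ∃ w : W, B v w ≠ 0) {χ : G → k}
    (h1 : finrank k ↥(⨅ g, Module.End.eigenspace (σ g) (χ g)⁻¹) = 1) {v : V}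
    (hv : v ∈ ⨅ g, Module.End.eigenspace (ρ g) (χ g)) (hv0 : v ≠ 0) {a : W}
    (ha : a ∈ ⨅ g, Module.End.eigenspace (σ g) (χ g)⁻¹) (ha0 : a ≠ 0) : B v a ≠ 0 := by
  obtain ⟨w', hw', hvw'⟩ := exists_pairing_ne_zero_of_nondegenerate hB hW hnd hv hv0
  exact pairing_ne_zero_of_finrank_eq_one h1 hw' hvw' ha ha0

/-- The weight spaces of a representation for two weights that differ somewhere meet only in `0`
(a vector in both would have `(χ g - χ' g) • v = 0`). -/
theorem weightSpace_inf_eq_bot_of_ne {ρ : Representation k G V} {χ χ' : G → k} (g : G)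
    (hne : χ g ≠ χ' g) :
    (⨅ g, Module.End.eigenspace (ρ g) (χ g)) ⊓ (⨅ g, Module.End.eigenspace (ρ g) (χ' g)) = ⊥ := by
  rw [Submodule.eq_bot_iff]
  intro v hv
  rw [Submodule.mem_inf, mem_weightSpace, mem_weightSpace] at hv
  have h1 : (χ g - χ' g) • v = 0 := by
    rw [sub_smul, ← hv.1 g, ← hv.2 g, sub_self]
  rcases smul_eq_zero.mp h1 with h2 | h2
  · exact absurd (sub_eq_zero.mp h2) hne
  · exact h2

/-- A representation on which `G` acts through a SINGLE weight `χ` (the case of a character,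
PERIOD.md §4.5 (α): `σ₀(v) = det^k`) is spanned by its weight spaces. -/
theorem iSup_weightSpace_eq_top_of_le {σ : Representation k G W} {χ : G → k}
    (h : ⊤ ≤ ⨅ g, Module.End.eigenspace (σ g) (χ g)) :
    ⨆ χ' : G → k, ⨅ g, Module.End.eigenspace (σ g) (χ' g) = ⊤ :=
  top_le_iff.mp (h.trans (le_iSup (fun χ' : G → k => ⨅ g, Module.End.eigenspace (σ g) (χ' g)) χ))

/-- In the application the opposite weight space is the whole of a CHARACTER `σ₀(v) = det^k` of
the compact group `U(W_v)` (PERIOD.md §4.5 (α)): a one-dimensional `W` on which `G` acts through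
the weight `χ` has a one-dimensional `χ`-weight space. -/
theorem finrank_weightSpace_eq_one_of_le {σ : Representation k G W} {χ : G → k}
    (h : ⊤ ≤ ⨅ g, Module.End.eigenspace (σ g) (χ g)) (h1 : finrank k W = 1) :
    finrank k ↥(⨅ g, Module.End.eigenspace (σ g) (χ g)) = 1 := by
  rw [top_le_iff.mp h, finrank_top]
  exact h1

end HodgeRepro.T3P1.WeightPairing
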